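import Summits.QuantumFields.YangMills.Theorems.BalabanUVNodesN19VacuumK5MGFRoad

/-!
# BalabanUVNodes ∕ N19 at cluster K5 — GUARD⁻ for the vacuum ∕ MGF road: the NECESSARY CONDITION every family in `MGFForm` satisfies,
# and the two-point (β)-toy on which the road's ONE displayed hypothesis FAILS (lens decomp v5, kill-test K14-β)

Cell `pub-ymgap` (HUMAN RULING D-0062, Track A), node N19 = NE7, R134 seat `pub-ymgap-dag-n19-c` (g6); the NEGATIVE sibling of the seat's positive
witness `Thm/BalabanUVNodesN19VacuumK5MGFRoadWitness.lean` (p485861) for `Thm/BalabanUVNodesN19VacuumK5MGFRoad.lean` (p482897, lens ROW VL-K5); lens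
ROW K14-β of `ym-lens-BalabanUVNodes-decomp` v5 (`LENS-decomp.md` 07acd831aa830b9f §v5.1 ∕ M19; §1–§2 of the lens sketch `LensDecompNE7v5.sketch.lean`
a021c8a8f95b66cf are LIFTED here, credited decl by decl).  Filed `--supports` K3′ «SpineGivenEndpointR12» (stmt-QuantumFields-19908) `--as helper`.
COUNT-NEUTRAL.  THEOREMS ONLY (the toy's quantities are written as explicit closed forms ∕ statement-local `let`s; 0 `def`); no Theses import; edits nothing.

WHAT THE ROAD DISPLAYS.  Every theorem of the MGF road (`…N19VacuumMGFRoad` :228 ∕ :325, `…N19VacuumK5MGFRoad` §1 (c) ∕ §2) carries ONE hypothesis the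
lens introduced: `DressedMGFForm.MGFForm Bo S.T Fo ν (fun K t τ ↦ S.A K t τ − S.shA K t τ)` — each shell-free dressed class weight is the moment generating
function of ONE bounded observable under a t-FREE finite class measure.  The positive witness (p485861) says the road FIRES; this file says ON WHAT it cannot.

* §1 [folklore] THE NECESSARY CONDITION.  `2 ≤ e^{x} + e^{−x}` (tree: `CTConjugationPieces.two_le_exp_add_exp_neg`; inlined); hence for a bounded
  measurable `X` under a finite measure `2·mgf(0) ≤ mgf(t) + mgf(−t)` (`two_mul_mgf_zero_le`); hence every family in `MGFForm` passes the two-sided test class by class (`mgfForm_two_mul_zero_le`), in particular the road's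
  shell-free cores `A − shA` (`core_two_mul_zero_le_of_mgfForm` — the road's letters verbatim): a CHECK any proposed spine-carrier reading `cr` must pass
  before `MGFForm … cr` is worth displaying.
* §2 [toy, exact arithmetic] ONE (0.3) [Balaban1989LargeFieldI] p. 176 R-step on a two-point fibre `y = ±1` (large-field piece `[y = +1]`, small-field
  piece `≡ 1∕4`, dressing `e^{t·y}`, selector L ↦ S) followed by the next characteristic function `[y = −1]`.  In CONVENTION (β) — DRESSED insert AND
  DRESSED normalisation, the shape of def-R's `rstepOfSel` ∕ `rratio` (`Node00/RStepRepr218.lean`) when run on DRESSED slots, i.e. of NODE 00's F3 tower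
  `Node00.dressedSlotsOfDatum₉` — the class weight is `W_β(t) = e^{−t}∕8 + 1∕(2(e^{t} + e^{−t}))` (`toyB_classWeight_eq`), RATIONAL in the fibre MGFs; it
  takes the values `1∕16 + 1∕5`, `1∕4 + 1∕5`, `3∕8` at `log 2`, `−log 2`, `0`, so `W_β(log 2) + W_β(−log 2) = 57∕80 < 60∕80 = 2·W_β(0)` (`toyB_two_sided_lt`):
  `W_β` is the MGF of NO bounded measurable observable under NO finite measure on NO space (`toyB_not_mgf`), and the one-class family `(K, t, τ) ↦ W_β(t)`
  admits NO `MGFForm` datum whatever the spaces, observables, measures and bound (`toyB_not_mgfForm` — the road's hypothesis TYPE, refuted on the toy).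
  In CONVENTION (α) — UNDRESSED insert and normalisation, dressed numerator (`T4DressedR.RopIn`, `DressedSizeDomination.ratioOp`, T4-DAG D5) — the same step
  gives `W_α(t) = e^{−t}∕8 + e^{t}∕4` (`toyA_classWeight_eq`): t-FREE nonnegative weights on the ORIGINAL fibre, literally an `MGFForm` datum
  (`toyA_mgfForm`: `Ω = Bool`, `ν = (1∕4)δ_true + (1∕8)δ_false`, `F = y`, `Bo = 1`), passing the test at every tilt (`toyA_two_sided_le`).  Both conventions
  preserve the total dressed mass ((0.4) p. 176 ∕ (1.102) p. 201; `toyB_total_eq`, `toyA_total_eq`) and agree at `t = 0` (`toyB_zero_eq_toyA_zero`): the fork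
  is INVISIBLE on `Z_K(t)`, on every vacuum node and on ROW VL's `t = 0` cores.

READING (lens v5 §v5.1, one sentence, for the headers of the road): `MGFForm` at a reading built from F3 `Node00.dressedSlotsOfDatum₉` HOLDS at the
selectors of record (`ppSelIdOfRecord`, `ppSelLiveOfRecord`: 𝐑 is there a t-free `{0,1}`-multiplier — lens ROW MF-ID, the companion module of this seat)
and FAILS in general at a contentful selector unless the dressed tower is re-typed in convention (α).

HONEST FRAMING.  A folklore inequality, a decided two-point toy and one Dirac-type `MGFForm` inhabitant; no content about Bałaban's runs or densities
([Balaban1989LargeFieldI] (0.3)–(0.4), (1.100)–(1.102) are cited for their SHAPE only); no tree theorem contradicted (the road displays `MGFForm` as a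
HYPOTHESIS — correct); NE7 ∕ NE7b ∕ NE7c ∕ NE1′ NOT proved; N19 ∕ N20 ∕ N21 NOT discharged; K3′ NOT claimed; counts UNMOVED (5∕27 · A 5∕28); one finite
four-torus programme — NOT ℝ⁴, NOT OS, NOT a mass gap, NOT Clay.  0 `def`; 0 `sorry`; standard axioms; [folklore] throughout.
-/

set_option autoImplicit false

noncomputable section

open Finset MeasureTheory ProbabilityTheory
open scoped BigOperators NNReal

namespace Summit.QuantumFields.YangMills.BalabanUVNodes.N19VacuumK5MGFRoadNoGo

open Literature.MathematicalPhysics.QuantumFieldTheory.Balaban1983to89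
open Summit.QuantumFields.BalabanUV.T4Continuum.NE1p.DressedMGFForm (MGFForm)

/-! ## §1 The necessary condition: an MGF-form function satisfies `2·A(0) ≤ A(t) + A(−t)` -/

section Necessary

variable {Ω : Type*} {mΩ : MeasurableSpace Ω} {ν : Measure Ω} [IsFiniteMeasure ν] {X : Ω → ℝ} {B : ℝ}

/-- **NECESSARY CONDITION FOR MGF FORM.**  For a bounded measurable `X` under a finite measure, `2·mgf(0) ≤ mgf(t) + mgf(−t)` for every real `t`
(integrate `2 ≤ e^{tX} + e^{−tX}`; `mgf(0)` is the mass).  Lens v5 sketch §1, lifted verbatim. [folklore] -/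
theorem two_mul_mgf_zero_le (hXm : Measurable X) (hB : ∀ ω, |X ω| ≤ B) (t : ℝ) :
    2 * mgf X ν 0 ≤ mgf X ν t + mgf X ν (-t) := by
  have hint : ∀ s : ℝ, Integrable (fun ω => Real.exp (s * X ω)) ν := fun s =>
    T4GenFunBounds.integrable_exp_mul_of_bound (μ := ν) hXm.aemeasurable (ae_of_all _ hB) s
  rw [mgf_zero', mgf, mgf, ← integral_add (hint t) (hint (-t))]
  have h2 : 2 * ν.real Set.univ = ∫ _ω, (2 : ℝ) ∂ν := by
    rw [integral_const, smul_eq_mul, mul_comm]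
  rw [h2]
  refine integral_mono (integrable_const _) ((hint t).add (hint (-t))) fun ω => ?_
  -- `2 ≤ e^{x} + e^{−x}` (twice `x + 1 ≤ e^{x}`; the tree's `CTConjugationPieces.two_le_exp_add_exp_neg`, inlined to keep the imports light)
  have h1 := Real.add_one_le_exp (t * X ω)
  have h2 := Real.add_one_le_exp (-(t * X ω))
  show (2 : ℝ) ≤ Real.exp (t * X ω) + Real.exp (-t * X ω)
  rw [neg_mul]
  linarith

end Necessary

section FormCorollary

variable {ι : Type*} {Ω : ℕ → Type*} [∀ K, MeasurableSpace (Ω K)]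
variable {Bo : ℝ} {T : ℕ → Finset ι} {Fo : ∀ K, Ω K → ℝ} {ν : ∀ K, ι → Measure (Ω K)} {A shA : ℕ → ℝ → ι → ℝ}

/-- **… FOR `DressedMGFForm.MGFForm`, CLASS BY CLASS**: `2·A K 0 τ ≤ A K t τ + A K (−t) τ` on every class `τ ∈ T K` — by the form's own fields
(`finite`, `repr`, `meas`, `bound`).  Lens v5 sketch §1, lifted verbatim. [folklore] -/
theorem mgfForm_two_mul_zero_le (h : MGFForm Bo T Fo ν A) (K : ℕ) (t : ℝ) {τ : ι} (hτ : τ ∈ T K) :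
    2 * A K 0 τ ≤ A K t τ + A K (-t) τ := by
  haveI := h.finite K τ hτ
  rw [h.repr K 0 τ hτ, h.repr K t τ hτ, h.repr K (-t) τ hτ]
  exact two_mul_mgf_zero_le (h.meas K) (h.bound K) t

/-- **THE CHECK ON THE ROAD'S LETTERS.**  The ONE displayed hypothesis of the MGF road — `MGFForm Bo T Fo ν (fun K t τ ↦ A K t τ − shA K t τ)` on the
shell-free DRESSED cores of a spine-carrier reading (`…N19VacuumMGFRoad` :228 ∕ :325, `…N19VacuumK5MGFRoad` §1 (c) ∕ §2, verbatim) — forces, on every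
class, `2·(A − shA)(K, 0, τ) ≤ (A − shA)(K, t, τ) + (A − shA)(K, −t, τ)`: a test any proposed reading `cr` must pass before the hypothesis is worth
displaying for it.  (§2: a (β)-tower at a contentful selector fails it.) [folklore] -/
theorem core_two_mul_zero_le_of_mgfForm (hmgf : MGFForm Bo T Fo ν (fun K t τ => A K t τ - shA K t τ)) (K : ℕ) (t : ℝ) {τ : ι}
    (hτ : τ ∈ T K) :
    2 * (A K 0 τ - shA K 0 τ) ≤ (A K t τ - shA K t τ) + (A K (-t) τ - shA K (-t) τ) :=
  mgfForm_two_mul_zero_le hmgf K t hτ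

end FormCorollary

/-! ## §2 The toy: one (0.3) R-step on a two-point fibre, conventions (β) and (α), then the next characteristic function -/

section Toy

/-- **THE (β) CLASS WEIGHT, DERIVED.**  Two-point fibre `y = ±1` (coded `y 0 = 1`, `y 1 = −1`), normalised fibre integral `(f 0 + f 1)∕2`, dressing
`e^{t·y}`, large-field piece `pL = [y = +1]`, small-field piece `pS ≡ 1∕4`, selector L ↦ S.  CONVENTION (β) (def-R's `rstepOfSel_TexpA` ∕ `rratio` run on
DRESSED slots): the post-𝐑 dressed slot at S is `pS·e^{ty}·(1 + ∫(pL·e^{ty}) ∕ ∫(pS·e^{ty}))` — DRESSED numerator over DRESSED normalisation; read through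
the next characteristic function `[y = −1]`, the class weight is `e^{−t}∕8 + 1∕(2(e^{t} + e^{−t}))` — RATIONAL in the fibre MGFs.  Lens v5 sketch §2
`WB_eq`, lifted with the toy's definitions made statement-local. [cite: Balaban1989LargeFieldI, (0.3) p.176 (shape only)] -/
theorem toyB_classWeight_eq (t : ℝ) :
    let y : Fin 2 → ℝ := fun i => if i = 0 then 1 else -1
    let fibInt : (Fin 2 → ℝ) → ℝ := fun f => (f 0 + f 1) / 2
    let dress : Fin 2 → ℝ := fun i => Real.exp (t * y i)
    let pL : Fin 2 → ℝ := fun i => if i = 0 then 1 else 0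
    let pS : Fin 2 → ℝ := fun _ => 1 / 4
    let ratioB : ℝ := fibInt (fun i => pL i * dress i) / fibInt (fun i => pS i * dress i)
    let slotB : Fin 2 → ℝ := fun i => pS i * dress i * (1 + ratioB)
    let chiNext : Fin 2 → ℝ := fun i => if i = 1 then 1 else 0
    fibInt (fun i => chiNext i * slotB i) = Real.exp (-t) / 8 + 1 / (2 * (Real.exp t + Real.exp (-t))) := by
  intro y fibInt dress pL pS ratioB slotB chiNext
  have hE : 0 < Real.exp t := Real.exp_pos t
  simp only [chiNext, slotB, ratioB, fibInt, pS, pL, dress, y, Fin.isValue, if_true, one_ne_zero, if_false, zero_ne_one, mul_one, mul_neg,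
    one_mul, zero_mul, zero_add, Real.exp_neg]
  field_simp
  ring

/-- **THE (α) CLASS WEIGHT, DERIVED.**  Same toy, CONVENTION (α) (`T4DressedR.RopIn` ∕ `RopRealIn`, `DressedSizeDomination.ratioOp`, T4-DAG D5): the identity
summand keeps the dressed slot, the moved summand rides on the UNDRESSED insert `pS` with the UNDRESSED normalisation `∫pS` and the DRESSED numerator
`∫(pL·e^{ty})`; read through `[y = −1]` the class weight is `e^{−t}∕8 + e^{t}∕4`.  Lens v5 sketch §2 `WA_eq`, lifted.
[cite: Balaban1989LargeFieldI, (0.3) p.176, (1.100) p.201 (shape only)] -/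
theorem toyA_classWeight_eq (t : ℝ) :
    let y : Fin 2 → ℝ := fun i => if i = 0 then 1 else -1
    let fibInt : (Fin 2 → ℝ) → ℝ := fun f => (f 0 + f 1) / 2
    let dress : Fin 2 → ℝ := fun i => Real.exp (t * y i)
    let pL : Fin 2 → ℝ := fun i => if i = 0 then 1 else 0
    let pS : Fin 2 → ℝ := fun _ => 1 / 4
    let ratioA : ℝ := fibInt (fun i => pL i * dress i) / fibInt pS
    let slotA : Fin 2 → ℝ := fun i => pS i * dress i + pS i * ratioA
    let chiNext : Fin 2 → ℝ := fun i => if i = 1 then 1 else 0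
    fibInt (fun i => chiNext i * slotA i) = Real.exp (-t) / 8 + Real.exp t / 4 := by
  intro y fibInt dress pL pS ratioA slotA chiNext
  simp only [chiNext, slotA, ratioA, fibInt, pS, pL, dress, y, Fin.isValue, if_true, one_ne_zero, if_false, zero_ne_one, mul_one, mul_neg,
    one_mul, zero_mul, zero_add]
  ring

/-- **BOTH CONVENTIONS PRESERVE THE TOTAL DRESSED MASS — (β)** ((0.4) p. 176 ∕ (1.102) p. 201 for the dressed density; `lintegral_rop03_dressed`): the
post-𝐑 (β)-slot integrates over the fibre to `∫(pS + pL)·e^{ty}`.  Lens v5 sketch §2 `total_slotB_eq`, lifted. [cite: Balaban1989LargeFieldI, (0.4) p.176 (shape only)] -/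
theorem toyB_total_eq (t : ℝ) :
    let y : Fin 2 → ℝ := fun i => if i = 0 then 1 else -1
    let fibInt : (Fin 2 → ℝ) → ℝ := fun f => (f 0 + f 1) / 2
    let dress : Fin 2 → ℝ := fun i => Real.exp (t * y i)
    let pL : Fin 2 → ℝ := fun i => if i = 0 then 1 else 0
    let pS : Fin 2 → ℝ := fun _ => 1 / 4
    let ratioB : ℝ := fibInt (fun i => pL i * dress i) / fibInt (fun i => pS i * dress i)
    let slotB : Fin 2 → ℝ := fun i => pS i * dress i * (1 + ratioB)
    fibInt slotB = fibInt (fun i => (pS i + pL i) * dress i) := by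
  intro y fibInt dress pL pS ratioB slotB
  have hpos : 0 < Real.exp t + Real.exp (-t) := by positivity
  simp only [slotB, ratioB, fibInt, pS, pL, dress, y, Fin.isValue, if_true, one_ne_zero, if_false, mul_one, mul_neg, one_mul, zero_mul,
    add_zero]
  field_simp
  ring

/-- **… AND (α)** (`T4DressedR.lintegral_ropIn`).  Lens v5 sketch §2 `total_slotA_eq`, lifted. [cite: Balaban1989LargeFieldI, (1.102) p.201 (shape only)] -/
theorem toyA_total_eq (t : ℝ) :
    let y : Fin 2 → ℝ := fun i => if i = 0 then 1 else -1
    let fibInt : (Fin 2 → ℝ) → ℝ := fun f => (f 0 + f 1) / 2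
    let dress : Fin 2 → ℝ := fun i => Real.exp (t * y i)
    let pL : Fin 2 → ℝ := fun i => if i = 0 then 1 else 0
    let pS : Fin 2 → ℝ := fun _ => 1 / 4
    let ratioA : ℝ := fibInt (fun i => pL i * dress i) / fibInt pS
    let slotA : Fin 2 → ℝ := fun i => pS i * dress i + pS i * ratioA
    fibInt slotA = fibInt (fun i => (pS i + pL i) * dress i) := by
  intro y fibInt dress pL pS ratioA slotA
  simp only [slotA, ratioA, fibInt, pS, pL, dress, y, Fin.isValue, if_true, one_ne_zero, if_false, mul_one, mul_neg, one_mul, zero_mul,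
    add_zero]
  ring

/-- **… AND AGREE AT `t = 0`**: `W_β(0) = W_α(0) = 3∕8` — the VACUUM class weights are convention-free (so the fork is invisible on every vacuum node and on
ROW VL's `t = 0` cores).  Lens v5 sketch §2 `WB_zero_eq_WA_zero`, on the closed forms. [folklore] -/
theorem toyB_zero_eq_toyA_zero :
    Real.exp (-0) / 8 + 1 / (2 * (Real.exp 0 + Real.exp (-0))) = Real.exp (-0) / 8 + Real.exp 0 / 4 := by
  rw [neg_zero, Real.exp_zero]; norm_num

/-- The (β) class weight at the test tilt `t₀ = log 2` (`e^{t₀} = 2`, `e^{−t₀} = 1∕2`): `W_β(log 2) = 1∕16 + 1∕5`. [folklore] -/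
theorem toyB_at_log_two :
    Real.exp (-Real.log 2) / 8 + 1 / (2 * (Real.exp (Real.log 2) + Real.exp (-Real.log 2))) = 1 / 16 + 1 / 5 := by
  rw [Real.exp_neg, Real.exp_log (by norm_num)]; norm_num

/-- … at `−t₀`: `W_β(−log 2) = 1∕4 + 1∕5`. [folklore] -/
theorem toyB_at_neg_log_two :
    Real.exp (-(-Real.log 2)) / 8 + 1 / (2 * (Real.exp (-Real.log 2) + Real.exp (-(-Real.log 2)))) = 1 / 4 + 1 / 5 := by
  rw [neg_neg, Real.exp_neg, Real.exp_log (by norm_num)]; norm_num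

/-- … and at `0`: `W_β(0) = 3∕8`. [folklore] -/
theorem toyB_at_zero : Real.exp (-0) / 8 + 1 / (2 * (Real.exp 0 + Real.exp (-0))) = 3 / 8 := by
  rw [neg_zero, Real.exp_zero]; norm_num

/-- **(β) VIOLATES THE NECESSARY CONDITION OF §1**: `W_β(log 2) + W_β(−log 2) = 57∕80 < 60∕80 = 2·W_β(0)` — the certificate of record (exact rationals).
Lens v5 sketch §2 `WB_two_sided_lt`, on the closed form. [folklore] -/
theorem toyB_two_sided_lt :
    let W : ℝ → ℝ := fun t => Real.exp (-t) / 8 + 1 / (2 * (Real.exp t + Real.exp (-t)))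
    W (Real.log 2) + W (-Real.log 2) < 2 * W 0 := by
  intro W
  simp only [W]
  rw [toyB_at_log_two, toyB_at_neg_log_two, toyB_at_zero]
  norm_num

/-- **K14 AGAINST CONVENTION (β), DECIDED: the (β) class weight is the MGF of NO bounded measurable observable under NO finite measure on NO space**
(§1 `two_mul_mgf_zero_le` at `t = log 2` against `toyB_two_sided_lt`).  Read: a spine-carrier reading `cr` built from F3's tower `Node00.dressedSlotsOfDatum₉`
with a selector that moves live large-field mass CANNOT satisfy `DressedMGFForm.MGFForm … cr` in general.  Lens v5 sketch §2 `WB_not_mgf`, lifted. [folklore] -/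
theorem toyB_not_mgf {Ω : Type*} [MeasurableSpace Ω] (ν : Measure Ω) [IsFiniteMeasure ν] (X : Ω → ℝ) (B : ℝ) (hXm : Measurable X)
    (hB : ∀ ω, |X ω| ≤ B) :
    ¬ (∀ t, Real.exp (-t) / 8 + 1 / (2 * (Real.exp t + Real.exp (-t))) = mgf X ν t) := by
  intro h
  have h1 := two_mul_mgf_zero_le (ν := ν) hXm hB (Real.log 2)
  rw [← h (Real.log 2), ← h (-Real.log 2), ← h 0, toyB_at_log_two, toyB_at_neg_log_two, toyB_at_zero] at h1
  norm_num at h1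

/-- **… SO THE ROAD'S HYPOTHESIS TYPE IS UNINHABITED ON THE (β)-TOY**: the one-class family `(K, t, τ) ↦ W_β(t)` admits NO datum
`MGFForm Bo T Fo ν (fun _ t _ ↦ W_β t)` — whatever the index type, the field spaces `Ω K`, the observables `Fo K`, the class measures `ν K τ` and the bound
`Bo` — as soon as one class set `T K` is non-empty.  (The road displays `MGFForm` as a HYPOTHESIS; this says which readings can never discharge it.) [folklore] -/
theorem toyB_not_mgfForm {ι : Type*} {Ω : ℕ → Type*} [∀ K, MeasurableSpace (Ω K)] {Bo : ℝ} {T : ℕ → Finset ι} {Fo : ∀ K, Ω K → ℝ}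
    {ν : ∀ K, ι → Measure (Ω K)} {K : ℕ} {τ : ι} (hτ : τ ∈ T K) :
    ¬ MGFForm Bo T Fo ν (fun _ t _ => Real.exp (-t) / 8 + 1 / (2 * (Real.exp t + Real.exp (-t)))) := by
  intro h
  haveI := h.finite K τ hτ
  exact toyB_not_mgf (ν K τ) (Fo K) Bo (h.meas K) (h.bound K) fun t => h.repr K t τ hτ

/-- … whereas the (α) class weight passes the two-sided test at every tilt (a nonnegative combination of `e^{±t}`).  Lens v5 sketch §2 `WA_two_sided_le`,
on the closed form. [folklore] -/
theorem toyA_two_sided_le (t : ℝ) :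
    let W : ℝ → ℝ := fun t => Real.exp (-t) / 8 + Real.exp t / 4
    2 * W 0 ≤ W t + W (-t) := by
  intro W
  simp only [W, neg_neg, neg_zero, Real.exp_zero]
  have h1 := Real.add_one_le_exp t
  have h2 := Real.add_one_le_exp (-t)
  nlinarith [h1, h2]

/-- **… INDEED THE (α) CLASS WEIGHT IS LITERALLY IN MGF FORM**: `W_α(t) = e^{−t}∕8 + e^{t}∕4 = ∫ e^{t·y} dν` for the t-FREE measure
`ν = (1∕4)·δ_true + (1∕8)·δ_false` on the ORIGINAL two-point fibre (`y true = 1`, `y false = −1`), so the one-class family `(K, t, τ) ↦ W_α(t)` IS an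
`MGFForm` datum with `Bo = 1` — the shape `DressedMGFForm.mgfForm_of_density` consumes; lens v5 sketch §2 `WA_eq_fibInt_tfree` made literal. [folklore] -/
theorem toyA_mgfForm {ι : Type*} (T : ℕ → Finset ι) :
    MGFForm (Ω := fun _ => Bool) 1 T (fun _ b => if b then (1 : ℝ) else -1)
      (fun _ _ => ((1 / 4 : ℝ≥0) • Measure.dirac true) + ((1 / 8 : ℝ≥0) • Measure.dirac false))
      (fun _ t _ => Real.exp (-t) / 8 + Real.exp t / 4) where
  nonneg := zero_le_one
  meas := fun _ => Measurable.of_discrete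
  bound := fun _ b => by split_ifs <;> simp
  finite := fun _ _ _ => inferInstance
  repr := fun K t τ _ => by
    have hint : ∀ (μ : Measure Bool) [IsFiniteMeasure μ],
        Integrable (fun b : Bool => Real.exp (t * (if b then (1 : ℝ) else -1))) μ := fun μ _ => Integrable.of_finite
    rw [mgf, integral_add_measure (hint _) (hint _), integral_smul_nnreal_measure, integral_smul_nnreal_measure, integral_dirac, integral_dirac]
    simp only [if_true, Bool.false_eq_true, if_false, mul_one, mul_neg, NNReal.smul_def, smul_eq_mul, NNReal.coe_div, NNReal.coe_one,
      NNReal.coe_ofNat]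
    ring

end Toy

end Summit.QuantumFields.YangMills.BalabanUVNodes.N19VacuumK5MGFRoadNoGo

end
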